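import Summits.QuantumFields.BalabanUV.Beta.RootedMixedJetSingle
import Summits.QuantumFields.BalabanUV.Beta.MixedLetterUnpacking

/-!
# `BalabanUV.Beta.RootedMixedTableLaw` — binder row D1, MIXED sub-chain «33M4»: **THE AXIS-REFLECTION LAW OF NODE 12b's TABLES
# `aTab`, `apTab`, `tTab` AND an1's BOND-LEVEL MIXED LAW `hMb` (MX4) — DISCHARGED** (β sub-cell, D1 swarm, an3 gen 33)

HONEST FRAMING (cell charter, verbatim): «discharging BetaPertH makes Bałaban's UV stability UNCONDITIONAL — a real
constructive-QFT result; it is NOT the continuum limit and NOT the Clay problem.»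
HONEST DEPENDENCY: continuum YM on T⁴ ⇐ BetaPertH ∧ nine spine estimates (0/9 proved); BetaPertH ⇐ (D1) ∧ (D4) ∧ CAP+tail;
G-an2-4 gates asym, D1 and NE2/3/4.
DERIVED cell leaf ([folklore] algebra over node 12b `AveragingMixedJetTables` (`MjetAt`, `UT`, `E`, `aTab`, `apTab`, `tTab`, `mixKerAt`),
node 7aρ `AveragingHessianKernelsRooted` (`linCountAt`, `hessCountAt`, `hessCountAt_swap`, `linKerAt`, `hessKerAt`), node 10
`ResolventReflection` (`bref`, `bref_bref`), `RootedKernelReflection` (`fref`), an3-g33's `RootedMixedJetSingle` (33M3c: `MjetAt_single_bref`,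
`sym3`) and leaf-05-g7's `MixedLetterUnpacking` (MX4: `mixKerAt_eq_tTab_cast`, `tableLaw_iff_bondLaw`, `mixedBinders_of_bondLaw`), all BY
NAME).  No statement of Bałaban's papers is typed, no `[cite:]`, no definition, no `Prop` is minted; no binder of the β-function wall
(`hW`∕`hR`∕`D1Tel`∕`D1Rep`, (D1), `BetaPertH`) is an input.  NOT D1, NOT BetaPertH, NOT continuum, NOT Clay.

## What this module proves
* §1 the `(0,3)` entries of the eight bracket words of 33M3c's law at node 12b's table letters `E₀₁, E₁₂, E₂₃`
  (finite `4 × 4` evaluation).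
* §2 **THE AXIS-REFLECTION LAWS OF THE TABLES** (`ρ_c = ctr d L`, `L` odd; `ε_h := −1` iff the bond `h` lies on the axis `α`,
  `h♯ := fref α h`; `h(·,·) := hessCountAt ρ_c L μ y`, `q(·) := linCountAt ρ_c L μ y`):
  `aTab ρ_c L μ (bref α μ y) f g f′ = ε_μ ε_f ε_{f′} ε_g · (aTab ρ_c L μ y f♯ g♯ f′♯
  − [f′ = g ∧ f′.1 = α]·(2L^d)⁻¹·(h(f♯,f′♯) + [f = f′]·q(f♯)) + [f = f′ = g ∧ f.1 = α]·L^{-d}·q(f♯)∕2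
  + [μ = α]·(2L^d)⁻¹L^{-d}·h(f♯,f′♯)·q(g♯))` (`aTab_bref`), the analogue for `apTab` (`apTab_bref`), and
  **`tTab_bref`**: `tTab ρ_c L μ (bref α μ y) f f′ g = ε_μ ε_f ε_{f′} ε_g · (tTab ρ_c L μ y f♯ f′♯ g♯
  − [f = g ∧ f.1 = α]·L^{-d}·h(f♯,f′♯) + [μ = α]·L^{-2d}·h(f♯,f′♯)·q(g♯))` — the `q`-contacts CANCEL (`½ − 1 − ½ = −1`
  against the doubled `[f = f′]·q`), the two `X2`'s of `aTab` and `apTab` cancel, and the commutator doubles by the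
  antisymmetry `hessCountAt_swap`.
* §3 **an1's BOND-LEVEL MIXED LAW `hMb` HOLDS** (`bondLaw`, `d = 4`, `Lc` odd): literally the right-hand side of MX4's `tableLaw_iff_bondLaw` ∕ the
  hypothesis `hB` of MX4's `mixedBinders_of_bondLaw` — by §2 cast to `ℝ` (`mixKerAt_eq_tTab_cast`); hence **an1's PACKED TABLE LAW `hM_an1`**
  (`tableLaw`, MX2's hypothesis) and **THE THREE MIXED BINDERS `(hM₀, hRM₀c, hRM₀p)` of `SpineRooted.…_of_an1_letters₀` at the Λ-lock
  `cΛ·Lc⁴ = 2`, UNCONDITIONALLY** (`mixedBinders`).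
NOT here: the border∕Ward letters (`hW`, Q-side), `hInv`, the row (D1) itself.  HONEST: 0∕4 binders of row D1 are discharged by this file ALONE
(it supplies the `hM`-input of K-P∕K-Q∕RX); NOT D1, NOT BetaPertH, NOT continuum, NOT Clay.
Provenance: β sub-cell, D1 formalisation swarm, unit b2b-balaban-beta-an3 gen 33, 2026-08-20 (v1); no existing file touched.
-/

open Literature.MathematicalPhysics.QuantumFieldTheory.Balaban1983to89
open Literature.MathematicalPhysics.QuantumFieldTheory.Balaban1983to89.Beta
open ExpKernelCalculus (MKer comp)
open AffineAveraging (toSite)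
open AveragingContoursRooted (ctr ctrOff)
open AveragingHessianKernels (Bond single)
open AveragingHessianKernelsRooted (linCountAt hessCountAt hessCountAt_swap hessCountAt_self linKerAt hessKerAt hessFFAt)
open AveragingMixedJetTables (MjetAt UT E aTab apTab tTab mixKerAt mixFFAt)
open PolarizationSign (reflSign)
open KernelReflection (refK)
open ResolventReflection (bref bref_bref Φ)
open RootedKernelReflection (fref)
open SecondOrderResponse (LocStencilFM)
open Summit.QuantumFields.BalabanUV.Beta.TameKernelCalculus (trK)
open Summit.QuantumFields.BalabanUV.Beta.BorderedHessian (sgnK diagK ctGen)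
open Summit.QuantumFields.BalabanUV.Beta.SecondOrderLetterLevels (MixedPrim)
open Summit.QuantumFields.BalabanUV.Beta.MixedLetterPacking (RMof)
open Summit.QuantumFields.BalabanUV.Beta.MixedLetterUnpacking (mixKerAt_eq_tTab_cast tableLaw_iff_bondLaw mixedBinders_of_bondLaw)
open Summit.QuantumFields.BalabanUV.Beta.RootedMixedJetSingle (sym3 MjetAt_single_bref)

namespace Summit.QuantumFields.BalabanUV.Beta.RootedMixedTableLaw

/-! ## §1 The `(0,3)` entries of the bracket words at the table letters -/

section Entries

/-- [folklore] `[E₁₂, [E₂₃, E₀₁]]₀₃ = 0`. -/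
theorem ent_X1_a : (AveragingHessianKernels.comm (E 1 2) (AveragingHessianKernels.comm (E 2 3) (E 0 1))) 0 3 = 0 := by
  simp [AveragingHessianKernels.comm, E]

/-- [folklore] `[E₂₃, [E₁₂, E₀₁]]₀₃ = 1`. -/
theorem ent_X1_ap : (AveragingHessianKernels.comm (E 2 3) (AveragingHessianKernels.comm (E 1 2) (E 0 1))) 0 3 = 1 := by
  simp [AveragingHessianKernels.comm, E]

/-- [folklore] `[E₀₁, [E₂₃, E₁₂]]₀₃ = −1`. -/
theorem ent_X2_a : (AveragingHessianKernels.comm (E 0 1) (AveragingHessianKernels.comm (E 2 3) (E 1 2))) 0 3 = -1 := by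
  simp [AveragingHessianKernels.comm, E]

/-- [folklore] `[E₀₁, [E₁₂, E₂₃]]₀₃ = 1`. -/
theorem ent_X2_ap : (AveragingHessianKernels.comm (E 0 1) (AveragingHessianKernels.comm (E 1 2) (E 2 3))) 0 3 = 1 := by
  simp [AveragingHessianKernels.comm, E]

/-- [folklore] `sym3(E₀₁, E₁₂, E₂₃)₀₃ = ½`. -/
theorem ent_X3_a : (sym3 ℚ (E 0 1) (E 1 2) (E 2 3)) 0 3 = 2⁻¹ := by
  simp [sym3, E]

/-- [folklore] `sym3(E₀₁, E₂₃, E₁₂)₀₃ = −1`. -/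
theorem ent_X3_ap : (sym3 ℚ (E 0 1) (E 2 3) (E 1 2)) 0 3 = -1 := by
  simp [sym3, E]

/-- [folklore] `[[E₀₁, E₁₂], E₂₃]₀₃ = 1`. -/
theorem ent_Xc_a : (AveragingHessianKernels.comm (AveragingHessianKernels.comm (E 0 1) (E 1 2)) (E 2 3)) 0 3 = 1 := by
  simp [AveragingHessianKernels.comm, E]

/-- [folklore] `[[E₀₁, E₂₃], E₁₂]₀₃ = 0`. -/
theorem ent_Xc_ap : (AveragingHessianKernels.comm (AveragingHessianKernels.comm (E 0 1) (E 2 3)) (E 1 2)) 0 3 = 0 := by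
  simp [AveragingHessianKernels.comm, E]

/-- [folklore] The `(0,3)` entry of a guarded matrix. -/
theorem ite_entry (P : Prop) [Decidable P] (X : UT) : (if P then X else 0) 0 3 = if P then X 0 3 else 0 := by
  split_ifs <;> rfl

end Entries

/-! ## §2 The axis-reflection laws of the tables `aTab`, `apTab`, `tTab` -/

section Tables

variable {d L : ℕ} (hL : Odd L)
include hL

/-- [folklore] **THE AXIS-REFLECTION LAW OF THE TABLE `aTab`** (33M3c's `MjetAt_single_bref` at the letters `E₀₁, E₁₂, E₂₃`,
entry `(0,3)`; §1). -/
theorem aTab_bref (α μ : Fin d) (f g f' : Bond d) (y : Fin d → ℤ) :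
    aTab (ctr d L) L μ (bref α μ y) f g f'
      = (if μ = α then -1 else 1 : ℚ)
        * ((if f.1 = α then -1 else 1 : ℚ) * (if f'.1 = α then -1 else 1 : ℚ) * (if g.1 = α then -1 else 1 : ℚ))
        * (aTab (ctr d L) L μ y (fref α f) (fref α g) (fref α f')
            - (if f' = g ∧ f'.1 = α then ((2 : ℚ) * (L : ℚ) ^ d)⁻¹
                * (hessCountAt (ctr d L) L μ y (fref α f) (fref α f') + (if f = f' then linCountAt (ctr d L) L μ y (fref α f) else 0)) else 0)
            + (if f = f' ∧ f' = g ∧ f.1 = α then ((L : ℚ) ^ d)⁻¹ * linCountAt (ctr d L) L μ y (fref α f) * 2⁻¹ else 0)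
            + (if μ = α then ((2 : ℚ) * (L : ℚ) ^ d)⁻¹ * ((L : ℚ) ^ d)⁻¹
                * (hessCountAt (ctr d L) L μ y (fref α f) (fref α f') * linCountAt (ctr d L) L μ y (fref α g)) else 0)) := by
  simp only [aTab]
  rw [congrFun (congrFun (MjetAt_single_bref (𝕜 := ℚ) hL two_ne_zero (Nat.cast_ne_zero.2 hL.pos.ne') α μ f f' g (E 0 1) (E 1 2) (E 2 3) y) 0) 3]
  simp only [Matrix.smul_apply, Matrix.add_apply, ite_entry, ent_X1_a, ent_X2_a, ent_X3_a, ent_Xc_a]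
  simp only [smul_eq_mul, zsmul_eq_mul, mul_zero, smul_zero, ite_self, add_zero]
  push_cast
  generalize (if f.1 = α then -1 else 1 : ℚ) = z₁
  generalize (if f'.1 = α then -1 else 1 : ℚ) = z₂
  generalize (if g.1 = α then -1 else 1 : ℚ) = z₃
  split_ifs <;> ring

/-- [folklore] **THE AXIS-REFLECTION LAW OF THE TABLE `apTab`** (letters `E₀₁, E₂₃, E₁₂`). -/
theorem apTab_bref (α μ : Fin d) (f g f' : Bond d) (y : Fin d → ℤ) :
    apTab (ctr d L) L μ (bref α μ y) f g f'
      = (if μ = α then -1 else 1 : ℚ)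
        * ((if f.1 = α then -1 else 1 : ℚ) * (if f'.1 = α then -1 else 1 : ℚ) * (if g.1 = α then -1 else 1 : ℚ))
        * (apTab (ctr d L) L μ y (fref α f) (fref α g) (fref α f')
            + (if f = g ∧ f.1 = α then ((2 : ℚ) * (L : ℚ) ^ d)⁻¹
                * (hessCountAt (ctr d L) L μ y (fref α f') (fref α f) + (if f' = f then linCountAt (ctr d L) L μ y (fref α f') else 0)) else 0)
            + (if f' = g ∧ f'.1 = α then ((2 : ℚ) * (L : ℚ) ^ d)⁻¹
                * (hessCountAt (ctr d L) L μ y (fref α f) (fref α f') + (if f = f' then linCountAt (ctr d L) L μ y (fref α f) else 0)) else 0)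
            - (if f = f' ∧ f' = g ∧ f.1 = α then ((L : ℚ) ^ d)⁻¹ * linCountAt (ctr d L) L μ y (fref α f) else 0)) := by
  simp only [apTab]
  rw [congrFun (congrFun (MjetAt_single_bref (𝕜 := ℚ) hL two_ne_zero (Nat.cast_ne_zero.2 hL.pos.ne') α μ f f' g (E 0 1) (E 2 3) (E 1 2) y) 0) 3]
  simp only [Matrix.smul_apply, Matrix.add_apply, ite_entry, ent_X1_ap, ent_X2_ap, ent_X3_ap, ent_Xc_ap]
  simp only [smul_eq_mul, zsmul_eq_mul, mul_zero, smul_zero, ite_self, add_zero]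
  push_cast
  generalize (if f.1 = α then -1 else 1 : ℚ) = z₁
  generalize (if f'.1 = α then -1 else 1 : ℚ) = z₂
  generalize (if g.1 = α then -1 else 1 : ℚ) = z₃
  split_ifs <;> ring

/-- [folklore] **THE AXIS-REFLECTION LAW OF THE DIAGONAL RECIPE `tTab`**: the `q`-contacts cancel, the `X2`'s cancel, the commutator doubles —
what is left is ONE Hessian contact `−[f = g ∧ f.1 = α]·L^{-d}·h(f♯, f′♯)` and the doubled commutator
`[μ = α]·L^{-2d}·h(f♯, f′♯)·q(g♯)`. -/
theorem tTab_bref (α μ : Fin d) (f f' g : Bond d) (y : Fin d → ℤ) :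
    tTab (ctr d L) L μ (bref α μ y) f f' g
      = (if μ = α then -1 else 1 : ℚ)
        * ((if f.1 = α then -1 else 1 : ℚ) * (if f'.1 = α then -1 else 1 : ℚ) * (if g.1 = α then -1 else 1 : ℚ))
        * (tTab (ctr d L) L μ y (fref α f) (fref α f') (fref α g)
            - (if f = g ∧ f.1 = α then ((L : ℚ) ^ d)⁻¹ * hessCountAt (ctr d L) L μ y (fref α f) (fref α f') else 0)
            + (if μ = α then ((L : ℚ) ^ d)⁻¹ * ((L : ℚ) ^ d)⁻¹
                * (hessCountAt (ctr d L) L μ y (fref α f) (fref α f') * linCountAt (ctr d L) L μ y (fref α g)) else 0)) := by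
  simp only [tTab]
  rw [aTab_bref hL α μ f g f' y, apTab_bref hL α μ f g f' y, aTab_bref hL α μ f' g f y,
    hessCountAt_swap (ctr d L) L μ y (fref α f) (fref α f')]
  generalize (if f.1 = α then -1 else 1 : ℚ) = z₁
  generalize (if f'.1 = α then -1 else 1 : ℚ) = z₂
  generalize (if g.1 = α then -1 else 1 : ℚ) = z₃
  by_cases hff : f = f'
  · subst hff
    simp only [hessCountAt_self, neg_zero, true_and, if_true]
    split_ifs <;> push_cast <;> ring
  · have hff' : ¬ f' = f := fun h => hff h.symm
    simp only [hff, hff', false_and, if_false]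
    split_ifs <;> push_cast <;> ring

end Tables

/-! ## §3 an1's bond-level mixed law `hMb`, the packed table law `hM_an1`, and the three mixed binders — discharged -/

section BondLaw

variable {Lc : ℕ}

/-- [folklore] `fref α (β, x) = (β, bref α β x)`. -/
theorem fref_mk {D : ℕ} (α β : Fin D) (x : Fin D → ℤ) : fref α (β, x) = (β, bref α β x) := rfl

/-- [folklore] The contact condition in bond language and in an1's letters agree. -/
theorem contact_iff {D : ℕ} (α β κ : Fin D) (x u : Fin D → ℤ) :
    ((β, x) = (κ, bref α κ u) ∧ β = α) ↔ (bref α β x = u ∧ β = κ ∧ κ = α) := by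
  constructor
  · rintro ⟨h, hβ⟩
    simp only [Prod.mk.injEq] at h
    obtain ⟨rfl, rfl⟩ := h
    exact ⟨bref_bref α β u, rfl, hβ⟩
  · rintro ⟨hx, rfl, hβ⟩
    refine ⟨?_, hβ⟩
    rw [← hx, bref_bref]

open Classical in
/-- [folklore] **an1's BOND-LEVEL MIXED REFLECTION LAW `hMb` HOLDS** (`Lc` odd): literally the hypothesis `hB` of MX4's `mixedBinders_of_bondLaw`
(the right-hand side of `tableLaw_iff_bondLaw`) — §2's `tTab_bref` at `d = 4` cast to `ℝ` by MX4's `mixKerAt_eq_tTab_cast`. -/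
theorem bondLaw (hLc : Odd Lc) :
    ∀ (α κ : Fin 4) (u : Fin 4 → ℤ) (ρ' : Fin 4) (w : Fin 4 → ℤ) (β : Fin 4) (x : Fin 4 → ℤ) (β' : Fin 4) (z : Fin 4 → ℤ),
      mixKerAt (toSite (ctrOff 4 Lc)) Lc ρ' (bref α ρ' w) (κ, bref α κ u) (β, x) (β', z)
        = reflSign α κ * reflSign α ρ' * (reflSign α β * reflSign α β' *
            (mixKerAt (toSite (ctrOff 4 Lc)) Lc ρ' w (κ, u) (β, bref α β x) (β', bref α β' z)
              + 2 * (if bref α β x = u ∧ β = κ ∧ κ = α then -1 else 0)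
                  * hessKerAt (toSite (ctrOff 4 Lc)) Lc ρ' w (β, bref α β x) (β', bref α β' z)
              + 2 * (if ρ' = α then linKerAt (toSite (ctrOff 4 Lc)) Lc ρ' w (κ, u) else 0)
                  * hessKerAt (toSite (ctrOff 4 Lc)) Lc ρ' w (β, bref α β x) (β', bref α β' z))) := by
  intro α κ u ρ' w β x β' z
  have hL0 : (Lc : ℝ) ≠ 0 := Nat.cast_ne_zero.2 hLc.pos.ne'
  have e := tTab_bref (d := 4) hLc α ρ' (β, x) (β', z) (κ, bref α κ u) w
  simp only [fref_mk, bref_bref, contact_iff] at e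
  rw [mixKerAt_eq_tTab_cast, mixKerAt_eq_tTab_cast, show toSite (ctrOff 4 Lc) = ctr 4 Lc from rfl, e]
  simp only [hessKerAt, linKerAt, reflSign, div_eq_mul_inv, mul_inv]
  split_ifs <;> push_cast <;> ring

/-- [folklore] **an1's PACKED TABLE-LEVEL MIXED LAW `hM_an1` HOLDS** (MX2's hypothesis; MX4's `tableLaw_iff_bondLaw`). -/
theorem tableLaw (hLc : Odd Lc) :
    ∀ (α κ : Fin 4) (u : Fin 4 → ℤ) (ρ' : Fin 4) (w : Fin 4 → ℤ),
      mixFFAt (toSite (ctrOff 4 Lc)) Lc κ (bref α κ u) ρ' (bref α ρ' w) =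
        (reflSign α κ * reflSign α ρ') • refK (Φ Lc α)
          (mixFFAt (toSite (ctrOff 4 Lc)) Lc κ u ρ' w
            + (2 : ℝ) • comp (diagK (ctGen 3 α Lc κ u)) (hessFFAt (toSite (ctrOff 4 Lc)) Lc ρ' w)
            + (2 * (if ρ' = α then linKerAt (toSite (ctrOff 4 Lc)) Lc ρ' w (κ, u) else 0)) • hessFFAt (toSite (ctrOff 4 Lc)) Lc ρ' w) :=
  tableLaw_iff_bondLaw.2 (bondLaw hLc)

/-- [folklore] **THE THREE MIXED BINDERS `(hM₀, hRM₀c, hRM₀p)` of `SpineRooted.…_of_an1_letters₀` AT THE Λ-LOCK `cΛ·Lc⁴ = 2` —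
UNCONDITIONAL**
(MX4's `mixedBinders_of_bondLaw` with its bond-law hypothesis discharged by `bondLaw`). -/
theorem mixedBinders [NeZero Lc] (hLc : Odd Lc) {cΛ : ℝ} (hΛ : cΛ * (Lc : ℝ) ^ 4 = 2) :
    MixedPrim Lc (toSite (ctrOff 4 Lc)) cΛ (mixFFAt (toSite (ctrOff 4 Lc)) Lc) (RMof Lc cΛ)
      ∧ (∀ α : Fin 4, ∃ C δ : ℝ, 0 < δ ∧ LocStencilFM Lc (RMof Lc cΛ α) C δ)
      ∧ (∀ (α κ : Fin 4) (u : Fin 4 → ℤ) (ρ' : Fin 4) (w : Fin 4 → ℤ),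
          trK (RMof Lc cΛ α κ u ρ' w) = -sgnK (RMof Lc cΛ α κ u ρ' w)) :=
  mixedBinders_of_bondLaw hLc hΛ (bondLaw hLc)

end BondLaw

end Summit.QuantumFields.BalabanUV.Beta.RootedMixedTableLaw
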